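import Mathlib
import HarnessLib

/-!
# Route `HalfSpaceWindowDoor`, crux `CirculationCarryingRigidity` (stmt-NavierStokesRegularity-25311) —
# line `angular_flux` (LEAD ns-hsw-p1 g13): CALCULUS OF THE GAUSSIAN HOURGLASS profile
# `Γ = Φ(1 − e^{−r²/4τ})`, `τ = −t + θ²z²`, its source `Q = Γ_t − Γ_rr + r⁻¹Γ_r − Γ_zz` and its flux `S = −r⁻¹∫₀ʳ ρQ`

Elementary real analysis (Mathlib only, no new definitions) feeding the tightness theorem
`…AngularFluxTightness.angularFlux_hourglass_model` (the model enemy of the one-axis circle calculus):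

* §1 `r`-derivatives of the Gaussian core and of the profile (`hasDerivAt_core_r`, `hasDerivAt_model_r`, `hasDerivAt_model_rr`);
* §2 the width parameter `τ` and the chain rules in `t` and `z` (`hasDerivAt_model_tau/_t/_z/_zz`, `tau_pos`);
* §3 Gaussian moments `∫₀ʳ ρ³e^{−ρ²/4τ}`, `∫₀ʳ ρ⁵e^{−ρ²/4τ}` in closed form and their two-regime bounds
  (`integral_rho3`, `integral_rho5`, `integral_rho3_le`, `integral_rho5_le`, `one_sub_mul_exp_le`);
* §4 the source `Q = (Φ r² e^{−r²/4τ}/2τ²)(1 + θ² + θ⁴z²r²/(2τ²) − 4θ⁴z²/τ)`: bracket bound, integrand bound, the FLUX BOUNDS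
  `|∫₀ʳ ρQ| ≤ Φ(4+36θ²)` and `≤ Φ(1+9θ²)r²/τ` (`abs_fluxIntegral_le`), and the flux law `∂ᵣS + r⁻¹S = −Q` for
  `S = −r⁻¹∫₀ʳρQ` (`flux_divergence`, fundamental theorem of calculus);
* §5 `Γ → Φ` as `r → ∞` (`tendsto_model`) and the elementary profile bounds (`model_bounds`).

Seat ns-hsw-p1 g13 (LEAD of 25311, cell pub-ns-dss), `--supports stmt-NavierStokesRegularity-25311 --as helper`.
WHAT THIS IS NOT: not a statement about Navier–Stokes regularity (Clay A); calculus of an explicit model profile (no velocity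
field, no NS dynamics); door statements concern HYPOTHETICAL blow-up profiles; nothing is closed by this file.
-/

noncomputable section

-- the summit and its single sub-problem share the name (CONVENTIONS §1), as in every Theorems file
set_option linter.dupNamespace false

namespace Summit.NavierStokesRegularity.NavierStokesRegularity.Theorems.HalfSpaceWindowDoorCirculationCarryingRigidityAngularFluxHourglass

open Set Filter Topology intervalIntegral MeasureTheory

/-! ### §1 The Gaussian core `E(r) = exp(−r²/(4τ))` in the radius, `τ > 0` a parameter -/

/-- `∂ᵣ exp(−r²/(4τ)) = −(r/(2τ)) exp(−r²/(4τ))`. -/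
theorem hasDerivAt_core_r (τ r : ℝ) :
    HasDerivAt (fun r' => Real.exp (-(r' ^ 2) / (4 * τ))) (-(r / (2 * τ)) * Real.exp (-(r ^ 2) / (4 * τ))) r := by
  have h : HasDerivAt (fun r' => -(r' ^ 2) / (4 * τ)) (-(2 * r) / (4 * τ)) r := by
    have := ((hasDerivAt_pow 2 r).neg).div_const (4 * τ)
    simpa using this
  refine (h.exp).congr_deriv ?_
  rcases eq_or_ne τ 0 with hτ | hτ
  · subst hτ; simp
  · field_simp
    ring

/-- `∂ᵣ [Φ(1 − exp(−r²/(4τ)))] = Φ exp(−r²/(4τ)) r/(2τ)`. -/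
theorem hasDerivAt_model_r (Φ τ r : ℝ) :
    HasDerivAt (fun r' => Φ * (1 - Real.exp (-(r' ^ 2) / (4 * τ))))
      (Φ * Real.exp (-(r ^ 2) / (4 * τ)) * r / (2 * τ)) r := by
  refine (((hasDerivAt_core_r τ r).const_sub 1).const_mul Φ).congr_deriv ?_
  ring

/-- `∂ᵣ [Φ exp(−r²/(4τ)) r/(2τ)] = Φ exp(−r²/(4τ)) (1/(2τ) − r²/(4τ²))`. -/
theorem hasDerivAt_model_rr (Φ τ r : ℝ) :
    HasDerivAt (fun r' => Φ * Real.exp (-(r' ^ 2) / (4 * τ)) * r' / (2 * τ))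
      (Φ * Real.exp (-(r ^ 2) / (4 * τ)) * (1 / (2 * τ) - r ^ 2 / (4 * τ ^ 2))) r := by
  have h := (((hasDerivAt_core_r τ r).const_mul Φ).mul (hasDerivAt_id r)).div_const (2 * τ)
  refine h.congr_deriv ?_
  rcases eq_or_ne τ 0 with hτ | hτ
  · subst hτ; simp
  · simp only [id]
    field_simp
    ring

/-! ### §2 The core as a function of the width parameter `τ`; the chain rules in `t` and `z` (`τ = −t + θ²z²`) -/

/-- `∂_τ [Φ(1 − exp(−r²/(4τ)))] = −Φ exp(−r²/(4τ)) r²/(4τ²)` for `τ ≠ 0`. -/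
theorem hasDerivAt_model_tau (Φ r : ℝ) {τ : ℝ} (hτ : τ ≠ 0) :
    HasDerivAt (fun τ' => Φ * (1 - Real.exp (-(r ^ 2) / (4 * τ'))))
      (-(Φ * Real.exp (-(r ^ 2) / (4 * τ)) * r ^ 2 / (4 * τ ^ 2))) τ := by
  have h1 : HasDerivAt (fun τ' => -(r ^ 2) / (4 * τ')) (r ^ 2 / (4 * τ ^ 2)) τ := by
    have h := (((hasDerivAt_id τ).const_mul 4).inv (by simpa using hτ : (4 : ℝ) * id τ ≠ 0)).const_mul (-(r ^ 2))
    refine (h.congr_of_eventuallyEq (Eventually.of_forall fun τ' => by simp [div_eq_mul_inv])).congr_deriv ?_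
    simp only [id, mul_one]
    field_simp
  refine (((h1.exp).const_sub 1).const_mul Φ).congr_deriv ?_
  ring

/-- `τ(z,t) = −t + θ²z² > 0` for `t < 0`. -/
theorem tau_pos (θ z : ℝ) {t : ℝ} (ht : t < 0) : 0 < -t + θ ^ 2 * z ^ 2 :=
  add_pos_of_pos_of_nonneg (neg_pos.mpr ht) (by positivity)

/-- `∂ₜ Γ = Φ exp(−r²/(4τ)) r²/(4τ²)` with `τ = −t + θ²z²`, `t < 0`. -/
theorem hasDerivAt_model_t (Φ θ r z : ℝ) {t : ℝ} (ht : t < 0) :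
    HasDerivAt (fun t' => Φ * (1 - Real.exp (-(r ^ 2) / (4 * (-t' + θ ^ 2 * z ^ 2)))))
      (Φ * Real.exp (-(r ^ 2) / (4 * (-t + θ ^ 2 * z ^ 2))) * r ^ 2 / (4 * (-t + θ ^ 2 * z ^ 2) ^ 2)) t := by
  have hτ' : HasDerivAt (fun t' => -t' + θ ^ 2 * z ^ 2) (-1) t := by
    simpa using (hasDerivAt_neg t).add_const (θ ^ 2 * z ^ 2)
  refine ((hasDerivAt_model_tau Φ r (tau_pos θ z ht).ne').comp t hτ').congr_deriv ?_
  ring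

/-- `∂_z Γ = −Φ exp(−r²/(4τ)) r² θ² z/(2τ²)` with `τ = −t + θ²z²`, `t < 0`. -/
theorem hasDerivAt_model_z (Φ θ r : ℝ) {t : ℝ} (ht : t < 0) (z : ℝ) :
    HasDerivAt (fun z' => Φ * (1 - Real.exp (-(r ^ 2) / (4 * (-t + θ ^ 2 * z' ^ 2)))))
      (-(Φ * Real.exp (-(r ^ 2) / (4 * (-t + θ ^ 2 * z ^ 2))) * r ^ 2 * θ ^ 2 * z
        / (2 * (-t + θ ^ 2 * z ^ 2) ^ 2))) z := by
  have hτ0 : -t + θ ^ 2 * z ^ 2 ≠ 0 := (tau_pos θ z ht).ne'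
  have hτ' : HasDerivAt (fun z' => -t + θ ^ 2 * z' ^ 2) (θ ^ 2 * (2 * z)) z := by
    simpa using ((hasDerivAt_pow 2 z).const_mul (θ ^ 2)).const_add (-t)
  refine ((hasDerivAt_model_tau Φ r hτ0).comp z hτ').congr_deriv ?_
  field_simp
  ring

/-- The `z`-derivative once more: `∂_z [−Φ E r²θ²z/(2τ²)] = −(Φ r²θ² E/(2τ²))·(1 + r²θ²z²/(2τ²) − 4θ²z²/τ)`
(`E = exp(−r²/(4τ))`, `τ = −t + θ²z²`, `t < 0`). -/
theorem hasDerivAt_model_zz (Φ θ r : ℝ) {t : ℝ} (ht : t < 0) (z : ℝ) :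
    HasDerivAt (fun z' => -(Φ * Real.exp (-(r ^ 2) / (4 * (-t + θ ^ 2 * z' ^ 2))) * r ^ 2 * θ ^ 2 * z'
        / (2 * (-t + θ ^ 2 * z' ^ 2) ^ 2)))
      (-(Φ * r ^ 2 * θ ^ 2 * Real.exp (-(r ^ 2) / (4 * (-t + θ ^ 2 * z ^ 2))) / (2 * (-t + θ ^ 2 * z ^ 2) ^ 2)
        * (1 + r ^ 2 * θ ^ 2 * z ^ 2 / (2 * (-t + θ ^ 2 * z ^ 2) ^ 2) - 4 * θ ^ 2 * z ^ 2 / (-t + θ ^ 2 * z ^ 2)))) z := by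
  have hτpos : ∀ z' : ℝ, 0 < -t + θ ^ 2 * z' ^ 2 := fun z' => tau_pos θ z' ht
  have hτ0 : -t + θ ^ 2 * z ^ 2 ≠ 0 := (hτpos z).ne'
  have hτ' : HasDerivAt (fun z' => -t + θ ^ 2 * z' ^ 2) (θ ^ 2 * (2 * z)) z := by
    simpa using ((hasDerivAt_pow 2 z).const_mul (θ ^ 2)).const_add (-t)
  -- the inner exponent and the Gaussian factor
  have hu : HasDerivAt (fun z' => -(r ^ 2) / (4 * (-t + θ ^ 2 * z' ^ 2)))
      (r ^ 2 * θ ^ 2 * z / (2 * (-t + θ ^ 2 * z ^ 2) ^ 2)) z := by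
    have h := ((hτ'.const_mul 4).inv (by positivity)).const_mul (-(r ^ 2))
    refine (h.congr_of_eventuallyEq (Eventually.of_forall fun z' => by simp [div_eq_mul_inv])).congr_deriv ?_
    field_simp
    ring
  have hE : HasDerivAt (fun z' => Real.exp (-(r ^ 2) / (4 * (-t + θ ^ 2 * z' ^ 2))))
      (Real.exp (-(r ^ 2) / (4 * (-t + θ ^ 2 * z ^ 2))) * (r ^ 2 * θ ^ 2 * z / (2 * (-t + θ ^ 2 * z ^ 2) ^ 2))) z :=
    hu.exp
  -- quotient rule for `E(z') z' / τ(z')²`, then the constant factor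
  have hnum : HasDerivAt (fun z' => Real.exp (-(r ^ 2) / (4 * (-t + θ ^ 2 * z' ^ 2))) * z')
      (Real.exp (-(r ^ 2) / (4 * (-t + θ ^ 2 * z ^ 2))) * (r ^ 2 * θ ^ 2 * z / (2 * (-t + θ ^ 2 * z ^ 2) ^ 2)) * z
        + Real.exp (-(r ^ 2) / (4 * (-t + θ ^ 2 * z ^ 2)))) z := by
    refine ((hE.mul (hasDerivAt_id z)).congr_of_eventuallyEq (Eventually.of_forall fun _ => rfl)).congr_deriv ?_
    simp only [id, mul_one]
  have hden : HasDerivAt (fun z' => (-t + θ ^ 2 * z' ^ 2) ^ 2) (2 * (-t + θ ^ 2 * z ^ 2) * (θ ^ 2 * (2 * z))) z := by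
    refine ((hτ'.pow 2).congr_of_eventuallyEq (Eventually.of_forall fun _ => rfl)).congr_deriv ?_
    norm_num
  have hq := ((hnum.div hden (pow_ne_zero 2 hτ0)).const_mul (-(Φ * r ^ 2 * θ ^ 2 / 2)))
  refine (hq.congr_of_eventuallyEq (Eventually.of_forall fun z' => ?_)).congr_deriv ?_
  · have hz' : -t + θ ^ 2 * z' ^ 2 ≠ 0 := (hτpos z').ne'
    simp only [Pi.div_apply]
    field_simp
  · field_simp
    ring

/-! ### §3 Gaussian moments on `[0, r]` -/

/-- `∫₀ʳ ρ³ e^{−ρ²/(4τ)} dρ = 8τ²(1 − (1 + r²/(4τ)) e^{−r²/(4τ)})` (`τ ≠ 0`). -/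
theorem integral_rho3 {τ : ℝ} (hτ : τ ≠ 0) (r : ℝ) :
    ∫ ρ in (0 : ℝ)..r, ρ ^ 3 * Real.exp (-(ρ ^ 2) / (4 * τ))
      = 8 * τ ^ 2 * (1 - (1 + r ^ 2 / (4 * τ)) * Real.exp (-(r ^ 2) / (4 * τ))) := by
  have hF : ∀ ρ : ℝ, HasDerivAt (fun ρ' => -(8 * τ ^ 2) * ((1 + ρ' ^ 2 / (4 * τ)) * Real.exp (-(ρ' ^ 2) / (4 * τ))))
      (ρ ^ 3 * Real.exp (-(ρ ^ 2) / (4 * τ))) ρ := fun ρ => by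
    have h1 : HasDerivAt (fun ρ' => 1 + ρ' ^ 2 / (4 * τ)) (2 * ρ / (4 * τ)) ρ := by
      simpa using ((hasDerivAt_pow 2 ρ).div_const (4 * τ)).const_add 1
    refine ((h1.mul (hasDerivAt_core_r τ ρ)).const_mul (-(8 * τ ^ 2))).congr_deriv ?_
    field_simp
    ring
  have hc : Continuous fun ρ : ℝ => ρ ^ 3 * Real.exp (-(ρ ^ 2) / (4 * τ)) := by fun_prop
  rw [integral_eq_sub_of_hasDerivAt (fun ρ _ => hF ρ) (hc.intervalIntegrable _ _)]
  simp
  ring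

/-- `∫₀ʳ ρ⁵ e^{−ρ²/(4τ)} dρ = 64τ³(1 − (1 + u + u²/2) e^{−u})`, `u = r²/(4τ)` (`τ ≠ 0`). -/
theorem integral_rho5 {τ : ℝ} (hτ : τ ≠ 0) (r : ℝ) :
    ∫ ρ in (0 : ℝ)..r, ρ ^ 5 * Real.exp (-(ρ ^ 2) / (4 * τ))
      = 64 * τ ^ 3 * (1 - (1 + r ^ 2 / (4 * τ) + (r ^ 2 / (4 * τ)) ^ 2 / 2) * Real.exp (-(r ^ 2) / (4 * τ))) := by
  have hF : ∀ ρ : ℝ, HasDerivAt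
      (fun ρ' => -(64 * τ ^ 3) * ((1 + ρ' ^ 2 / (4 * τ) + (ρ' ^ 2 / (4 * τ)) ^ 2 / 2) * Real.exp (-(ρ' ^ 2) / (4 * τ))))
      (ρ ^ 5 * Real.exp (-(ρ ^ 2) / (4 * τ))) ρ := fun ρ => by
    have hu : HasDerivAt (fun ρ' => ρ' ^ 2 / (4 * τ)) (2 * ρ / (4 * τ)) ρ := by
      simpa using (hasDerivAt_pow 2 ρ).div_const (4 * τ)
    have h1 : HasDerivAt (fun ρ' => 1 + ρ' ^ 2 / (4 * τ) + (ρ' ^ 2 / (4 * τ)) ^ 2 / 2)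
        (2 * ρ / (4 * τ) + 2 * (ρ ^ 2 / (4 * τ)) * (2 * ρ / (4 * τ)) / 2) ρ := by
      have h := (hu.const_add 1).add ((hu.pow 2).div_const 2)
      refine h.congr_deriv ?_
      norm_num
    refine ((h1.mul (hasDerivAt_core_r τ ρ)).const_mul (-(64 * τ ^ 3))).congr_deriv ?_
    field_simp
    ring
  have hc : Continuous fun ρ : ℝ => ρ ^ 5 * Real.exp (-(ρ ^ 2) / (4 * τ)) := by fun_prop
  rw [integral_eq_sub_of_hasDerivAt (fun ρ _ => hF ρ) (hc.intervalIntegrable _ _)]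
  simp
  ring

/-- `1 − (1 + u) e^{−u} ∈ [0, u]`-type bounds: for `u ≥ 0` and `p ≥ 0`, `0 ≤ (1 + u + p) e^{−u}` and
`1 − (1 + u + p) e^{−u} ≤ u` (from `e^{−u} ≥ 1 − u`). -/
theorem one_sub_mul_exp_le {u p : ℝ} (hu : 0 ≤ u) (hp : 0 ≤ p) :
    0 ≤ (1 + u + p) * Real.exp (-u) ∧ 1 - (1 + u + p) * Real.exp (-u) ≤ u := by
  have he : 0 ≤ Real.exp (-u) := (Real.exp_pos _).le
  have h1 : 1 - u ≤ Real.exp (-u) := by linarith [Real.add_one_le_exp (-u)]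
  refine ⟨by positivity, ?_⟩
  nlinarith [mul_nonneg (add_nonneg hu hp) he]

/-- The two third-moment bounds: `∫₀ʳ ρ³e^{−ρ²/4τ} ≤ 8τ²` and `≤ 2τ r²` (`τ > 0`). -/
theorem integral_rho3_le {τ : ℝ} (hτ : 0 < τ) (r : ℝ) :
    (∫ ρ in (0 : ℝ)..r, ρ ^ 3 * Real.exp (-(ρ ^ 2) / (4 * τ))) ≤ 8 * τ ^ 2 ∧
      (∫ ρ in (0 : ℝ)..r, ρ ^ 3 * Real.exp (-(ρ ^ 2) / (4 * τ))) ≤ 2 * τ * r ^ 2 := by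
  rw [integral_rho3 hτ.ne']
  have hu : 0 ≤ r ^ 2 / (4 * τ) := by positivity
  have hexp : Real.exp (-(r ^ 2) / (4 * τ)) = Real.exp (-(r ^ 2 / (4 * τ))) := by rw [neg_div]
  obtain ⟨h0, h1⟩ := one_sub_mul_exp_le hu le_rfl
  rw [add_zero] at h0 h1
  rw [hexp]
  constructor
  · nlinarith [sq_nonneg τ]
  · have : 8 * τ ^ 2 * (r ^ 2 / (4 * τ)) = 2 * τ * r ^ 2 := by field_simp; ring
    nlinarith [sq_nonneg τ]

/-- The two fifth-moment bounds: `∫₀ʳ ρ⁵e^{−ρ²/4τ} ≤ 64τ³` and `≤ 16τ² r²` (`τ > 0`). -/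
theorem integral_rho5_le {τ : ℝ} (hτ : 0 < τ) (r : ℝ) :
    (∫ ρ in (0 : ℝ)..r, ρ ^ 5 * Real.exp (-(ρ ^ 2) / (4 * τ))) ≤ 64 * τ ^ 3 ∧
      (∫ ρ in (0 : ℝ)..r, ρ ^ 5 * Real.exp (-(ρ ^ 2) / (4 * τ))) ≤ 16 * τ ^ 2 * r ^ 2 := by
  rw [integral_rho5 hτ.ne']
  have hu : 0 ≤ r ^ 2 / (4 * τ) := by positivity
  have hp : 0 ≤ (r ^ 2 / (4 * τ)) ^ 2 / 2 := by positivity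
  have hexp : Real.exp (-(r ^ 2) / (4 * τ)) = Real.exp (-(r ^ 2 / (4 * τ))) := by rw [neg_div]
  obtain ⟨h0, h1⟩ := one_sub_mul_exp_le hu hp
  rw [hexp]
  have hτ3 : 0 < τ ^ 3 := by positivity
  constructor
  · nlinarith
  · have : 64 * τ ^ 3 * (r ^ 2 / (4 * τ)) = 16 * τ ^ 2 * r ^ 2 := by field_simp; ring
    nlinarith

/-! ### §4 The source `Q = Γ_t − Γ_rr + r⁻¹Γ_r − Γ_zz` and the flux `S = −r⁻¹∫₀ʳ ρQ` -/

/-- The angular bracket of `Q` is bounded: with `τ = −t + θ²z²`, `t < 0` (so `0 ≤ θ²z² ≤ τ`),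
`|1 + θ² + θ⁴z²ρ²/(2τ²) − 4θ⁴z²/τ| ≤ 1 + 5θ² + θ²ρ²/(2τ)`. -/
theorem abs_bracket_le (θ z ρ : ℝ) {t : ℝ} (ht : t < 0) :
    |1 + θ ^ 2 + θ ^ 4 * z ^ 2 * ρ ^ 2 / (2 * (-t + θ ^ 2 * z ^ 2) ^ 2) - 4 * θ ^ 4 * z ^ 2 / (-t + θ ^ 2 * z ^ 2)|
      ≤ 1 + 5 * θ ^ 2 + θ ^ 2 * ρ ^ 2 / (2 * (-t + θ ^ 2 * z ^ 2)) := by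
  have hτ := tau_pos θ z ht
  set τ := -t + θ ^ 2 * z ^ 2 with hτdef
  have hm : θ ^ 2 * z ^ 2 ≤ τ := by rw [hτdef]; linarith
  have hm0 : 0 ≤ θ ^ 2 * z ^ 2 := by positivity
  -- `θ⁴z²ρ²/(2τ²) ≤ θ²ρ²/(2τ)` and `4θ⁴z²/τ ≤ 4θ²`
  have h1 : θ ^ 4 * z ^ 2 * ρ ^ 2 / (2 * τ ^ 2) ≤ θ ^ 2 * ρ ^ 2 / (2 * τ) := by
    rw [div_le_div_iff₀ (by positivity) (by positivity)]
    have : θ ^ 4 * z ^ 2 * ρ ^ 2 * (2 * τ) = (θ ^ 2 * z ^ 2) * (θ ^ 2 * ρ ^ 2 * 2) * τ := by ring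
    rw [this]
    have : θ ^ 2 * ρ ^ 2 * (2 * τ ^ 2) = τ * (θ ^ 2 * ρ ^ 2 * 2) * τ := by ring
    rw [this]
    exact mul_le_mul_of_nonneg_right (mul_le_mul_of_nonneg_right hm (by positivity)) hτ.le
  have h2 : 4 * θ ^ 4 * z ^ 2 / τ ≤ 4 * θ ^ 2 := by
    rw [div_le_iff₀ hτ]
    have : 4 * θ ^ 4 * z ^ 2 = 4 * θ ^ 2 * (θ ^ 2 * z ^ 2) := by ring
    rw [this]
    exact mul_le_mul_of_nonneg_left hm (by positivity)
  have h1' : 0 ≤ θ ^ 4 * z ^ 2 * ρ ^ 2 / (2 * τ ^ 2) := by positivity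
  have h2' : 0 ≤ 4 * θ ^ 4 * z ^ 2 / τ := by positivity
  rw [abs_le]
  constructor <;> nlinarith [sq_nonneg θ]

/-- Pointwise bound on the flux integrand `ρ Q(ρ)` for `ρ ≥ 0`, `Φ ≥ 0`, `t < 0` (`τ = −t + θ²z²`):
`|ρ Q(ρ)| ≤ (Φ(1+5θ²)/(2τ²)) ρ³ e^{−ρ²/4τ} + (Φθ²/(4τ³)) ρ⁵ e^{−ρ²/4τ}`. -/
theorem abs_rhoQ_le {Φ : ℝ} (hΦ : 0 ≤ Φ) (θ z : ℝ) {t : ℝ} (ht : t < 0) {ρ : ℝ} (hρ : 0 ≤ ρ) :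
    |ρ * (Φ * ρ ^ 2 * Real.exp (-(ρ ^ 2) / (4 * (-t + θ ^ 2 * z ^ 2))) / (2 * (-t + θ ^ 2 * z ^ 2) ^ 2)
        * (1 + θ ^ 2 + θ ^ 4 * z ^ 2 * ρ ^ 2 / (2 * (-t + θ ^ 2 * z ^ 2) ^ 2) - 4 * θ ^ 4 * z ^ 2 / (-t + θ ^ 2 * z ^ 2)))|
      ≤ Φ * (1 + 5 * θ ^ 2) / (2 * (-t + θ ^ 2 * z ^ 2) ^ 2) * (ρ ^ 3 * Real.exp (-(ρ ^ 2) / (4 * (-t + θ ^ 2 * z ^ 2))))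
        + Φ * θ ^ 2 / (4 * (-t + θ ^ 2 * z ^ 2) ^ 3) * (ρ ^ 5 * Real.exp (-(ρ ^ 2) / (4 * (-t + θ ^ 2 * z ^ 2)))) := by
  have hb := abs_bracket_le θ z ρ ht
  have hτ := tau_pos θ z ht
  set τ := -t + θ ^ 2 * z ^ 2 with hτdef
  set E := Real.exp (-(ρ ^ 2) / (4 * τ)) with hE
  have hE0 : 0 ≤ E := (Real.exp_pos _).le
  set B := 1 + θ ^ 2 + θ ^ 4 * z ^ 2 * ρ ^ 2 / (2 * τ ^ 2) - 4 * θ ^ 4 * z ^ 2 / τ with hB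
  have hpre : 0 ≤ ρ * (Φ * ρ ^ 2 * E / (2 * τ ^ 2)) := by positivity
  calc |ρ * (Φ * ρ ^ 2 * E / (2 * τ ^ 2) * B)|
      = ρ * (Φ * ρ ^ 2 * E / (2 * τ ^ 2)) * |B| := by
        rw [← mul_assoc, abs_mul, abs_of_nonneg hpre]
    _ ≤ ρ * (Φ * ρ ^ 2 * E / (2 * τ ^ 2)) * (1 + 5 * θ ^ 2 + θ ^ 2 * ρ ^ 2 / (2 * τ)) :=
        mul_le_mul_of_nonneg_left hb hpre
    _ = Φ * (1 + 5 * θ ^ 2) / (2 * τ ^ 2) * (ρ ^ 3 * E) + Φ * θ ^ 2 / (4 * τ ^ 3) * (ρ ^ 5 * E) := by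
        field_simp
        ring

/-- The flux integrand `ρ ↦ ρ Q(ρ)` is continuous. -/
theorem continuous_rhoQ (Φ θ z t : ℝ) :
    Continuous fun ρ : ℝ => ρ * (Φ * ρ ^ 2 * Real.exp (-(ρ ^ 2) / (4 * (-t + θ ^ 2 * z ^ 2))) / (2 * (-t + θ ^ 2 * z ^ 2) ^ 2)
        * (1 + θ ^ 2 + θ ^ 4 * z ^ 2 * ρ ^ 2 / (2 * (-t + θ ^ 2 * z ^ 2) ^ 2) - 4 * θ ^ 4 * z ^ 2 / (-t + θ ^ 2 * z ^ 2))) := by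
  fun_prop

/-- **FLUX BOUNDS.**  For `Φ ≥ 0`, `t < 0`, `r ≥ 0`, `τ = −t + θ²z²`:
`|∫₀ʳ ρQ dρ| ≤ Φ(4 + 36θ²)` (space–time far-field form) and `|∫₀ʳ ρQ dρ| ≤ Φ(1 + 9θ²) r²/τ` (time-only form). -/
theorem abs_fluxIntegral_le {Φ : ℝ} (hΦ : 0 ≤ Φ) (θ z : ℝ) {t : ℝ} (ht : t < 0) {r : ℝ} (hr : 0 ≤ r) :
    |∫ ρ in (0 : ℝ)..r, ρ * (Φ * ρ ^ 2 * Real.exp (-(ρ ^ 2) / (4 * (-t + θ ^ 2 * z ^ 2))) / (2 * (-t + θ ^ 2 * z ^ 2) ^ 2)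
        * (1 + θ ^ 2 + θ ^ 4 * z ^ 2 * ρ ^ 2 / (2 * (-t + θ ^ 2 * z ^ 2) ^ 2) - 4 * θ ^ 4 * z ^ 2 / (-t + θ ^ 2 * z ^ 2)))|
        ≤ Φ * (4 + 36 * θ ^ 2) ∧
      |∫ ρ in (0 : ℝ)..r, ρ * (Φ * ρ ^ 2 * Real.exp (-(ρ ^ 2) / (4 * (-t + θ ^ 2 * z ^ 2))) / (2 * (-t + θ ^ 2 * z ^ 2) ^ 2)
        * (1 + θ ^ 2 + θ ^ 4 * z ^ 2 * ρ ^ 2 / (2 * (-t + θ ^ 2 * z ^ 2) ^ 2) - 4 * θ ^ 4 * z ^ 2 / (-t + θ ^ 2 * z ^ 2)))|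
        ≤ Φ * (1 + 9 * θ ^ 2) * r ^ 2 / (-t + θ ^ 2 * z ^ 2) := by
  have hτ := tau_pos θ z ht
  set τ := -t + θ ^ 2 * z ^ 2 with hτdef
  set a := Φ * (1 + 5 * θ ^ 2) / (2 * τ ^ 2) with ha
  set b := Φ * θ ^ 2 / (4 * τ ^ 3) with hb
  have ha0 : 0 ≤ a := by positivity
  have hb0 : 0 ≤ b := by positivity
  have hc3 : Continuous fun ρ : ℝ => ρ ^ 3 * Real.exp (-(ρ ^ 2) / (4 * τ)) := by fun_prop
  have hc5 : Continuous fun ρ : ℝ => ρ ^ 5 * Real.exp (-(ρ ^ 2) / (4 * τ)) := by fun_prop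
  -- `|∫ ρQ| ≤ ∫ (a ρ³E + b ρ⁵E) = a J₃ + b J₅`
  have hle : |∫ ρ in (0 : ℝ)..r, ρ * (Φ * ρ ^ 2 * Real.exp (-(ρ ^ 2) / (4 * τ)) / (2 * τ ^ 2)
        * (1 + θ ^ 2 + θ ^ 4 * z ^ 2 * ρ ^ 2 / (2 * τ ^ 2) - 4 * θ ^ 4 * z ^ 2 / τ))|
      ≤ a * (∫ ρ in (0 : ℝ)..r, ρ ^ 3 * Real.exp (-(ρ ^ 2) / (4 * τ)))
          + b * (∫ ρ in (0 : ℝ)..r, ρ ^ 5 * Real.exp (-(ρ ^ 2) / (4 * τ))) := by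
    rw [← intervalIntegral.integral_const_mul, ← intervalIntegral.integral_const_mul,
      ← intervalIntegral.integral_add ((hc3.const_mul a).intervalIntegrable _ _ |>.congr fun _ _ => rfl)
        ((hc5.const_mul b).intervalIntegrable _ _ |>.congr fun _ _ => rfl), ← Real.norm_eq_abs]
    refine intervalIntegral.norm_integral_le_of_norm_le hr (Eventually.of_forall fun ρ hρ => ?_) ?_
    · rw [Real.norm_eq_abs]
      have h := abs_rhoQ_le hΦ θ z ht (le_of_lt hρ.1)
      simpa only [ha, hb] using h
    · exact ((hc3.const_mul a).add (hc5.const_mul b)).intervalIntegrable _ _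
  obtain ⟨h3a, h3b⟩ := integral_rho3_le hτ r
  obtain ⟨h5a, h5b⟩ := integral_rho5_le hτ r
  constructor
  · calc _ ≤ a * (8 * τ ^ 2) + b * (64 * τ ^ 3) := hle.trans (by gcongr)
      _ = Φ * (4 + 36 * θ ^ 2) := by rw [ha, hb]; field_simp; ring
  · calc _ ≤ a * (2 * τ * r ^ 2) + b * (16 * τ ^ 2 * r ^ 2) := hle.trans (by gcongr)
      _ = Φ * (1 + 9 * θ ^ 2) * r ^ 2 / τ := by rw [ha, hb]; field_simp; ring

/-- **The flux `S = −r⁻¹∫₀ʳ ρQ` solves `∂ᵣS + r⁻¹S = −Q`** (`r ≠ 0`; fundamental theorem of calculus). -/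
theorem flux_divergence (Φ θ z t : ℝ) {r : ℝ} (hr : r ≠ 0) :
    deriv (fun r' => -(∫ ρ in (0 : ℝ)..r', ρ * (Φ * ρ ^ 2 * Real.exp (-(ρ ^ 2) / (4 * (-t + θ ^ 2 * z ^ 2)))
          / (2 * (-t + θ ^ 2 * z ^ 2) ^ 2) * (1 + θ ^ 2 + θ ^ 4 * z ^ 2 * ρ ^ 2 / (2 * (-t + θ ^ 2 * z ^ 2) ^ 2)
            - 4 * θ ^ 4 * z ^ 2 / (-t + θ ^ 2 * z ^ 2)))) / r') r
      + r⁻¹ * (-(∫ ρ in (0 : ℝ)..r, ρ * (Φ * ρ ^ 2 * Real.exp (-(ρ ^ 2) / (4 * (-t + θ ^ 2 * z ^ 2)))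
          / (2 * (-t + θ ^ 2 * z ^ 2) ^ 2) * (1 + θ ^ 2 + θ ^ 4 * z ^ 2 * ρ ^ 2 / (2 * (-t + θ ^ 2 * z ^ 2) ^ 2)
            - 4 * θ ^ 4 * z ^ 2 / (-t + θ ^ 2 * z ^ 2)))) / r)
    = -(Φ * r ^ 2 * Real.exp (-(r ^ 2) / (4 * (-t + θ ^ 2 * z ^ 2))) / (2 * (-t + θ ^ 2 * z ^ 2) ^ 2)
        * (1 + θ ^ 2 + θ ^ 4 * z ^ 2 * r ^ 2 / (2 * (-t + θ ^ 2 * z ^ 2) ^ 2) - 4 * θ ^ 4 * z ^ 2 / (-t + θ ^ 2 * z ^ 2))) := by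
  have hI := ((continuous_rhoQ Φ θ z t).integral_hasStrictDerivAt 0 r).hasDerivAt
  have hS := (hI.neg.div (hasDerivAt_id r) hr).congr_of_eventuallyEq
    (f := fun r' => -(∫ ρ in (0 : ℝ)..r', ρ * (Φ * ρ ^ 2 * Real.exp (-(ρ ^ 2) / (4 * (-t + θ ^ 2 * z ^ 2)))
          / (2 * (-t + θ ^ 2 * z ^ 2) ^ 2) * (1 + θ ^ 2 + θ ^ 4 * z ^ 2 * ρ ^ 2 / (2 * (-t + θ ^ 2 * z ^ 2) ^ 2)
            - 4 * θ ^ 4 * z ^ 2 / (-t + θ ^ 2 * z ^ 2)))) / r') (Eventually.of_forall fun _ => rfl)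
  rw [hS.deriv]
  simp only [id, mul_one, Pi.neg_apply]
  field_simp
  ring

/-! ### §5 Limit and elementary bounds of the profile -/

/-- `Γ → Φ` as `r → ∞` on every plane: `exp(−r²/(4τ)) → 0` (`τ > 0`). -/
theorem tendsto_model {τ : ℝ} (hτ : 0 < τ) (Φ : ℝ) :
    Tendsto (fun r : ℝ => Φ * (1 - Real.exp (-(r ^ 2) / (4 * τ)))) atTop (𝓝 Φ) := by
  have h1 : Tendsto (fun r : ℝ => -(r ^ 2) / (4 * τ)) atTop atBot := by
    have h := tendsto_neg_atTop_atBot.comp ((tendsto_pow_atTop two_ne_zero).atTop_div_const (by positivity : 0 < 4 * τ))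
    refine h.congr fun r => ?_
    simp [neg_div]
  have h2 := Real.tendsto_exp_atBot.comp h1
  have h3 := (tendsto_const_nhds (x := (1 : ℝ))).sub h2
  simpa using h3.const_mul Φ

/-- The elementary bounds of the profile `Φ(1 − e^{−r²/4τ})` (`Φ ≥ 0`, `τ > 0`): nonnegative, `≤ Φ`, `≤ Φ r²/(4τ)`,
zero at `r = 0`, positive for `r ≠ 0` when `Φ > 0`. -/
theorem model_bounds {Φ τ : ℝ} (hΦ : 0 ≤ Φ) (hτ : 0 < τ) (r : ℝ) :
    0 ≤ Φ * (1 - Real.exp (-(r ^ 2) / (4 * τ))) ∧ Φ * (1 - Real.exp (-(r ^ 2) / (4 * τ))) ≤ Φ ∧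
      Φ * (1 - Real.exp (-(r ^ 2) / (4 * τ))) ≤ Φ * (r ^ 2 / (4 * τ)) := by
  have hu : 0 ≤ r ^ 2 / (4 * τ) := by positivity
  have he0 : 0 < Real.exp (-(r ^ 2) / (4 * τ)) := Real.exp_pos _
  have he1 : Real.exp (-(r ^ 2) / (4 * τ)) ≤ 1 := by
    rw [Real.exp_le_one_iff, neg_div]; exact neg_nonpos.mpr hu
  have he2 : 1 - r ^ 2 / (4 * τ) ≤ Real.exp (-(r ^ 2) / (4 * τ)) := by
    have := Real.add_one_le_exp (-(r ^ 2) / (4 * τ)); rw [neg_div] at this ⊢; linarith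
  exact ⟨mul_nonneg hΦ (by linarith), by nlinarith, mul_le_mul_of_nonneg_left (by linarith) hΦ⟩

end Summit.NavierStokesRegularity.NavierStokesRegularity.Theorems.HalfSpaceWindowDoorCirculationCarryingRigidityAngularFluxHourglass

end
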